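import Summits.CriticalPhenomena.PercolationContinuityZ3.Theorems.PercNearOneGluingNoHeavyLowerTailSahiE3PatternCertificate
import Summits.CriticalPhenomena.PercolationContinuityZ3.Theorems.PercNearOneGluingNoHeavyLowerTailSahiE3ProductSections
import Mathlib.Tactic.Linarith
import Mathlib.Tactic.Ring
import Mathlib.Tactic.Positivity
import HarnessLib
import HarnessLib.Audit

/-!
# `NoHeavyLowerTail` (crux stmt-CriticalPhenomena-4575), Sahi programme P4 (Holley / monotone coupling):
# the independent OR-step `V ∨ G` — the PAIR inequality is free for the marginal composite

Support file (cell `prim-l12`, seat P4, generation 18; `--supports stmt-CriticalPhenomena-4575`).  No named facts, no sorries;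
standard axioms; def-free.

Setting (normalised, flow-free form of `…SahiE3CertSandwich`): finite posets `B, Q` with probability weights `w, ν' ≥ 0`
satisfying Harris' inequality for up-sets, up-sets `V ⊆ B` (`v = w(V)`) and `G ⊆ Q` (`g = ν'(G)`, `ḡ = ν'(Gᶜ)`), and functions
`R_V ≥ 0` on `B`, `R_G ≥ 0` on `Q` satisfying the PAIR (lower sandwich) inequalities of their slots,
`(L_V)  w(I)·w(I'∩V) + w(I')·w(I∩V) − v·w(I)w(I') ≤ R_V(I ∩ I')` for all up-sets `I, I'` (and `(L_G)` likewise).  On `B × Q` with the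
product weight `ν = w ⊗ ν'` consider the slot `U = V × Q ∪ B × G` ("`V ∨ G`", the OR of two slots on disjoint blocks of variables).

THEOREM `pair_marginal_composite`.  The MARGINAL COMPOSITE `R⋆(b,t) = w(b)·R_G(t) + ḡ·R_V(b)·ν'(t)` satisfies the pair inequality
of `U`: for all up-sets `S, S'` of `B × Q`,
  `ν(S)·ν(S'∩U) + ν(S')·ν(S∩U) − ν(U)·ν(S)ν(S') ≤ Σ_{x ∈ S∩S'} R⋆(x)`.
Its total mass is `g + ḡv = ν(U)`.  So for the independent OR-step the pair condition (L) is NEVER the obstruction: what `R⋆` violates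
is the CAP condition (C) of `…SahiE3CertSandwich` (it carries `vg(1+ḡ)` on `V × G`, where every certificate of `U` carries exactly
`(1+v̄ḡ)vg`, HOME prim-l12-p4 gen-18 memo); the open problem is to trade the excess `v²gḡ` on `V × G` against the slack of this proof.

PROOF (marginalisation).  Write `a_t = w(S^t)` (`B`-sections, increasing in `t`), `ā_b = ν'(S_b)` (`Q`-sections, increasing in `b`),
`A = ν(S)`.  Then `ν(S∩U) = Σ_{t∈G} ν'(t)a_t + Σ_{s∉G} ν'(s)w(S^s ∩ V)` and
`need = [A·B_G + B·A_G − g·AB] + [A·B_{VḠ} + B·A_{VḠ} − vḡ·AB]` (`A_G = Σ_{t∈G} ν' a_t`, `A_{VḠ} = Σ_{b∈V} w(b)ν'(S_b ∖ G)`).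
The first bracket is `(L_G)` in functional form applied to the increasing functions `a, a'` on `Q`, hence `≤ Σ_t R_G(t)a_t a'_t
≤ Σ_t R_G(t)·w(S^t ∩ S'^t)` (Harris on `B`, section by section).  In the second, Harris on `Q` gives `ν'(S_b ∖ G) ≤ ḡ·ν'(S_b)`, so it is
`≤ ḡ·[A·B̄_V + B·Ā_V − v·AB]` (`Ā_V = Σ_{b∈V} w(b)ā_b`) `≤ ḡ Σ_b R_V(b) ā_b ā'_b` ((L_V) in functional form) `≤ ḡ Σ_b R_V(b)ν'(S_b ∩ S'_b)`
(Harris on `Q`).  The functional forms follow from the indicator forms by the layer cake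
(`…SahiE3PatternCertificate.bilin_nonneg_of_upperSets`).
-/

namespace Summit.CriticalPhenomena.PercolationContinuityZ3.Theorems.SahiE3IndepOrMarginal

open Finset Literature.Combinatorics.Sahi2008 SahiE3PatternCertificate SahiE3ProductSections
open scoped BigOperators

/-! ### The pair inequality in functional form -/

section Functional

variable {P : Type*} [Fintype P] [DecidableEq P] [PartialOrder P]

/-- **Functional form of the pair (lower sandwich) inequality.**  If `μ(I)μ(I'∩V) + μ(I')μ(I∩V) − c·μ(I)μ(I') ≤ R(I∩I')` for all
up-sets `I, I'`, then for all monotone `f, h ≥ 0`: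
`(Σ μf)(Σ_V μh) + (Σ μh)(Σ_V μf) − c(Σ μf)(Σ μh) ≤ Σ_t R(t) f(t) h(t)` (layer cake in both arguments). [this work] -/
theorem pair_functional (μ R : P → ℝ) (V : Finset P) (c : ℝ)
    (hpair : ∀ I I' : Finset P, IsUpperSet (I : Set P) → IsUpperSet (I' : Set P) →
      (∑ t ∈ I, μ t) * (∑ t ∈ I' ∩ V, μ t) + (∑ t ∈ I', μ t) * (∑ t ∈ I ∩ V, μ t)
        - c * (∑ t ∈ I, μ t) * (∑ t ∈ I', μ t) ≤ ∑ t ∈ I ∩ I', R t)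
    {f h : P → ℝ} (hf0 : ∀ t, 0 ≤ f t) (hfm : Monotone f) (hh0 : ∀ t, 0 ≤ h t) (hhm : Monotone h) :
    (∑ t, μ t * f t) * (∑ t ∈ V, μ t * h t) + (∑ t, μ t * h t) * (∑ t ∈ V, μ t * f t)
        - c * (∑ t, μ t * f t) * (∑ t, μ t * h t) ≤ ∑ t, R t * (f t * h t) := by
  have key := bilin_nonneg_of_upperSets
    (fun a b : P → ℝ => (∑ t, R t * (a t * b t)) - ((∑ t, μ t * a t) * (∑ t ∈ V, μ t * b t)
      + (∑ t, μ t * b t) * (∑ t ∈ V, μ t * a t) - c * (∑ t, μ t * a t) * (∑ t, μ t * b t)))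
    (fun f g h => by
      simp only [sum_mul_mul_add_left, sum_mul_add]; ring)
    (fun c f h => by
      simp only [sum_mul_mul_smul_left, sum_mul_smul]; ring)
    (fun f g h => by
      simp only [mul_comm (f _) _, sum_mul_mul_add_left, sum_mul_add]; ring)
    (fun c f g => by
      simp only [mul_comm (f _) _, sum_mul_mul_smul_left, sum_mul_smul]; ring)
    (fun S S' hS hS' => by
      simp only [sum_mul_setInd_mul, sum_mul_setInd, Finset.univ_inter]
      have h := hpair S S' hS hS'
      rw [Finset.inter_comm V S', Finset.inter_comm V S]
      linarith)
    hf0 hfm hh0 hhm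
  linarith [key]

/-- **Functional form of Harris' inequality** (normalised weight): if `μ(I)μ(I') ≤ μ(I∩I')` for up-sets, then
`(Σ μf)(Σ μh) ≤ Σ μ f h` for monotone `f, h ≥ 0`. [folklore] -/
theorem harris_functional (μ : P → ℝ)
    (hH : ∀ I I' : Finset P, IsUpperSet (I : Set P) → IsUpperSet (I' : Set P) →
      (∑ t ∈ I, μ t) * (∑ t ∈ I', μ t) ≤ ∑ t ∈ I ∩ I', μ t)
    {f h : P → ℝ} (hf0 : ∀ t, 0 ≤ f t) (hfm : Monotone f) (hh0 : ∀ t, 0 ≤ h t) (hhm : Monotone h) :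
    (∑ t, μ t * f t) * (∑ t, μ t * h t) ≤ ∑ t, μ t * (f t * h t) := by
  have key := bilin_nonneg_of_upperSets
    (fun a b : P → ℝ => (∑ t, μ t * (a t * b t)) - (∑ t, μ t * a t) * (∑ t, μ t * b t))
    (fun f g h => by
      simp only [sum_mul_mul_add_left, sum_mul_add]; ring)
    (fun c f h => by
      simp only [sum_mul_mul_smul_left, sum_mul_smul]; ring)
    (fun f g h => by
      simp only [mul_comm (f _) _, sum_mul_mul_add_left, sum_mul_add]; ring)
    (fun c f g => by
      simp only [mul_comm (f _) _, sum_mul_mul_smul_left, sum_mul_smul]; ring)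
    (fun S S' hS hS' => by
      simp only [sum_mul_setInd_mul, sum_mul_setInd, Finset.univ_inter]
      linarith [hH S S' hS hS'])
    hf0 hfm hh0 hhm
  linarith [key]

end Functional

/-! ### The marginal composite on `B × Q` -/

variable {B Q : Type*} [Fintype B] [DecidableEq B] [PartialOrder B] [Fintype Q] [DecidableEq Q] [PartialOrder Q]

omit [Fintype B] [DecidableEq B] [PartialOrder B] in
/-- Section masses are monotone under inclusion of the section (nonnegative weight). [folklore] -/
theorem secmass_mono {w : B → ℝ} (hw : ∀ b, 0 ≤ w b) {X Y : Finset B} (h : X ⊆ Y) :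
    ∑ b ∈ X, w b ≤ ∑ b ∈ Y, w b :=
  Finset.sum_le_sum_of_subset_of_nonneg h fun b _ _ => hw b

/-- **The pair inequality of `V ∨ G` is free for the marginal composite.**  Normalised Harris weights `w` on `B`, `ν'` on `Q`;
`V ⊆ B` (any subset), an up-set `G ⊆ Q`; `R_V, R_G ≥ 0` satisfying the pair inequalities `(L_V)`, `(L_G)`; `ν = w ⊗ ν'` and
`U = {(b,t) | b ∈ V ∨ t ∈ G}`.  Then `R⋆(b,t) = w(b)R_G(t) + ν'(Gᶜ)·R_V(b)ν'(t)` satisfies the pair inequality of `U` for every two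
up-sets `S, S'` of `B × Q`. [this work] -/
theorem pair_marginal_composite {w : B → ℝ} {ν' : Q → ℝ} (hw : ∀ b, 0 ≤ w b) (hν' : ∀ t, 0 ≤ ν' t)
    (hwZ : ∑ b, w b = 1) (hν'Z : ∑ t, ν' t = 1)
    (hHB : ∀ I I' : Finset B, IsUpperSet (I : Set B) → IsUpperSet (I' : Set B) →
      (∑ b ∈ I, w b) * (∑ b ∈ I', w b) ≤ ∑ b ∈ I ∩ I', w b)
    (hHQ : ∀ J J' : Finset Q, IsUpperSet (J : Set Q) → IsUpperSet (J' : Set Q) →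
      (∑ t ∈ J, ν' t) * (∑ t ∈ J', ν' t) ≤ ∑ t ∈ J ∩ J', ν' t)
    (V : Finset B) (G : Finset Q) (hG : IsUpperSet (G : Set Q))
    (RV : B → ℝ) (RG : Q → ℝ) (hRV0 : ∀ b, 0 ≤ RV b) (hRG0 : ∀ t, 0 ≤ RG t)
    (hpairV : ∀ I I' : Finset B, IsUpperSet (I : Set B) → IsUpperSet (I' : Set B) →
      (∑ b ∈ I, w b) * (∑ b ∈ I' ∩ V, w b) + (∑ b ∈ I', w b) * (∑ b ∈ I ∩ V, w b)
        - (∑ b ∈ V, w b) * (∑ b ∈ I, w b) * (∑ b ∈ I', w b) ≤ ∑ b ∈ I ∩ I', RV b)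
    (hpairG : ∀ J J' : Finset Q, IsUpperSet (J : Set Q) → IsUpperSet (J' : Set Q) →
      (∑ t ∈ J, ν' t) * (∑ t ∈ J' ∩ G, ν' t) + (∑ t ∈ J', ν' t) * (∑ t ∈ J ∩ G, ν' t)
        - (∑ t ∈ G, ν' t) * (∑ t ∈ J, ν' t) * (∑ t ∈ J', ν' t) ≤ ∑ t ∈ J ∩ J', RG t)
    (ν : B × Q → ℝ) (hν : ∀ x, ν x = w x.1 * ν' x.2)
    (U : Finset (B × Q)) (hU : ∀ x, x ∈ U ↔ (x.1 ∈ V ∨ x.2 ∈ G))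
    (S S' : Finset (B × Q)) (hS : IsUpperSet (S : Set (B × Q))) (hS' : IsUpperSet (S' : Set (B × Q))) :
    (∑ x ∈ S, ν x) * (∑ x ∈ S' ∩ U, ν x) + (∑ x ∈ S', ν x) * (∑ x ∈ S ∩ U, ν x)
        - (∑ x ∈ U, ν x) * (∑ x ∈ S, ν x) * (∑ x ∈ S', ν x)
      ≤ ∑ x ∈ S ∩ S', (w x.1 * RG x.2 + (∑ t ∈ Gᶜ, ν' t) * RV x.1 * ν' x.2) := by
  -- names for the scalars
  obtain ⟨v, hv⟩ : ∃ x : ℝ, ∑ b ∈ V, w b = x := ⟨_, rfl⟩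
  obtain ⟨g, hg⟩ : ∃ x : ℝ, ∑ t ∈ G, ν' t = x := ⟨_, rfl⟩
  obtain ⟨gb, hgb⟩ : ∃ x : ℝ, ∑ t ∈ Gᶜ, ν' t = x := ⟨_, rfl⟩
  have hggb : g + gb = 1 := by rw [← hg, ← hgb, Finset.sum_add_sum_compl, hν'Z]
  rw [hv] at hpairV; rw [hg] at hpairG
  -- sections
  set Sb : B → Finset Q := fun b => univ.filter (fun t => (b, t) ∈ S) with hSb
  set S'b : B → Finset Q := fun b => univ.filter (fun t => (b, t) ∈ S') with hS'b
  set St : Q → Finset B := fun t => univ.filter (fun b => (b, t) ∈ S) with hSt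
  set S't : Q → Finset B := fun t => univ.filter (fun b => (b, t) ∈ S') with hS't
  -- section functions: `a t = w(S^t)` on `Q`, `ā b = ν'(S_b)` on `B`
  set a : Q → ℝ := fun t => ∑ b ∈ St t, w b with ha
  set a' : Q → ℝ := fun t => ∑ b ∈ S't t, w b with ha'
  set ab : B → ℝ := fun b => ∑ t ∈ Sb b, ν' t with hab
  set ab' : B → ℝ := fun b => ∑ t ∈ S'b b, ν' t with hab'
  have ha0 : ∀ t, 0 ≤ a t := fun t => Finset.sum_nonneg fun b _ => hw b
  have ha'0 : ∀ t, 0 ≤ a' t := fun t => Finset.sum_nonneg fun b _ => hw b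
  have hab0 : ∀ b, 0 ≤ ab b := fun b => Finset.sum_nonneg fun t _ => hν' t
  have hab'0 : ∀ b, 0 ≤ ab' b := fun b => Finset.sum_nonneg fun t _ => hν' t
  have ham : Monotone a := fun t t' htt' =>
    secmass_mono hw fun b hb => by
      simp only [hSt, Finset.mem_filter, Finset.mem_univ, true_and] at hb ⊢
      exact hS (Prod.mk_le_mk.2 ⟨le_rfl, htt'⟩) hb
  have ha'm : Monotone a' := fun t t' htt' =>
    secmass_mono hw fun b hb => by
      simp only [hS't, Finset.mem_filter, Finset.mem_univ, true_and] at hb ⊢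
      exact hS' (Prod.mk_le_mk.2 ⟨le_rfl, htt'⟩) hb
  have habm : Monotone ab := fun b b' hbb' =>
    Finset.sum_le_sum_of_subset_of_nonneg (fun t ht => by
      simp only [hSb, Finset.mem_filter, Finset.mem_univ, true_and] at ht ⊢
      exact hS (Prod.mk_le_mk.2 ⟨hbb', le_rfl⟩) ht) fun t _ _ => hν' t
  have hab'm : Monotone ab' := fun b b' hbb' =>
    Finset.sum_le_sum_of_subset_of_nonneg (fun t ht => by
      simp only [hS'b, Finset.mem_filter, Finset.mem_univ, true_and] at ht ⊢
      exact hS' (Prod.mk_le_mk.2 ⟨hbb', le_rfl⟩) ht) fun t _ _ => hν' t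
  -- masses of `S`, `S'` in both section forms
  have eA_B : ∑ x ∈ S, ν x = ∑ t, ν' t * a t := by
    rw [sum_sectionsB]; refine Finset.sum_congr rfl fun t _ => ?_
    rw [Finset.mul_sum]; exact Finset.sum_congr rfl fun b _ => by rw [hν]; ring
  have eA'_B : ∑ x ∈ S', ν x = ∑ t, ν' t * a' t := by
    rw [sum_sectionsB]; refine Finset.sum_congr rfl fun t _ => ?_
    rw [Finset.mul_sum]; exact Finset.sum_congr rfl fun b _ => by rw [hν]; ring
  have eA_Q : ∑ x ∈ S, ν x = ∑ b, w b * ab b := by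
    rw [sum_sectionsQ]; refine Finset.sum_congr rfl fun b _ => ?_
    rw [Finset.mul_sum]; exact Finset.sum_congr rfl fun t _ => by rw [hν]
  have eA'_Q : ∑ x ∈ S', ν x = ∑ b, w b * ab' b := by
    rw [sum_sectionsQ]; refine Finset.sum_congr rfl fun b _ => ?_
    rw [Finset.mul_sum]; exact Finset.sum_congr rfl fun t _ => by rw [hν]
  -- the `U`-masses: `ν(S ∩ U) = Σ_{t∈G} ν' a_t + Σ_{b∈V} w(b) ν'(S_b ∖ G)`
  have secU : ∀ (X : Finset (B × Q)), IsUpperSet (X : Set (B × Q)) →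
      ∑ x ∈ X ∩ U, ν x = (∑ t ∈ G, ν' t * ∑ b ∈ univ.filter (fun b => (b, t) ∈ X), w b)
        + ∑ b ∈ V, w b * ∑ t ∈ (univ.filter (fun t => (b, t) ∈ X)) ∩ Gᶜ, ν' t := by
    intro X _
    -- split `X ∩ U` into the part over `G` and the part over `Gᶜ`
    have e1 : ∑ x ∈ X ∩ U, ν x = ∑ x ∈ (X ∩ U).filter (fun x => x.2 ∈ G), ν x
        + ∑ x ∈ (X ∩ U).filter (fun x => x.2 ∉ G), ν x :=
      (Finset.sum_filter_add_sum_filter_not _ _ _).symm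
    have f1 : (X ∩ U).filter (fun x => x.2 ∈ G) = X.filter (fun x => x.2 ∈ G) := by
      ext ⟨b, t⟩; simp only [Finset.mem_filter, Finset.mem_inter, hU]; tauto
    have f2 : (X ∩ U).filter (fun x => x.2 ∉ G) = X.filter (fun x => x.1 ∈ V ∧ x.2 ∉ G) := by
      ext ⟨b, t⟩; simp only [Finset.mem_filter, Finset.mem_inter, hU]; tauto
    rw [e1, f1, f2]
    congr 1
    · rw [sum_sectionsB]
      rw [← Finset.sum_filter_add_sum_filter_not univ (fun t => t ∈ G)]
      have z : ∑ t ∈ univ.filter (fun t => t ∉ G), ∑ b ∈ univ.filter (fun b => (b, t) ∈ X.filter (fun x => x.2 ∈ G)), ν (b, t) = 0 :=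
        Finset.sum_eq_zero fun t ht => by
          have ht' : t ∉ G := (Finset.mem_filter.1 ht).2
          refine Finset.sum_eq_zero fun b hb => ?_
          simp only [Finset.mem_filter, Finset.mem_univ, true_and] at hb
          exact absurd hb.2 ht'
      rw [z, add_zero, Finset.filter_mem_eq_inter, Finset.univ_inter]
      refine Finset.sum_congr rfl fun t ht => ?_
      rw [Finset.mul_sum]
      have fs : univ.filter (fun b => (b, t) ∈ X.filter (fun x => x.2 ∈ G)) = univ.filter (fun b => (b, t) ∈ X) := by
        ext b; simp [ht]
      rw [fs]; exact Finset.sum_congr rfl fun b _ => by rw [hν]; ring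
    · rw [sum_sectionsQ]
      rw [← Finset.sum_filter_add_sum_filter_not univ (fun b => b ∈ V)]
      have z : ∑ b ∈ univ.filter (fun b => b ∉ V), ∑ t ∈ univ.filter (fun t => (b, t) ∈ X.filter (fun x => x.1 ∈ V ∧ x.2 ∉ G)), ν (b, t) = 0 :=
        Finset.sum_eq_zero fun b hb => by
          have hb' : b ∉ V := (Finset.mem_filter.1 hb).2
          refine Finset.sum_eq_zero fun t ht => ?_
          simp only [Finset.mem_filter, Finset.mem_univ, true_and] at ht
          exact absurd ht.2.1 hb'
      rw [z, add_zero, Finset.filter_mem_eq_inter, Finset.univ_inter]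
      refine Finset.sum_congr rfl fun b hb => ?_
      rw [Finset.mul_sum]
      have fs : univ.filter (fun t => (b, t) ∈ X.filter (fun x => x.1 ∈ V ∧ x.2 ∉ G)) =
          univ.filter (fun t => (b, t) ∈ X) ∩ Gᶜ := by
        ext t; simp [hb]
      rw [fs]; exact Finset.sum_congr rfl fun t _ => by rw [hν]
  -- Harris on `Q` inside a section: `ν'(S_b ∖ G) ≤ ḡ ν'(S_b)`
  have secGc : ∀ b, ∑ t ∈ Sb b ∩ Gᶜ, ν' t ≤ gb * ab b := by
    intro b
    have hup : IsUpperSet ((Sb b : Finset Q) : Set Q) := isUpperSet_secQ hS b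
    have h1 := hHQ (Sb b) G hup hG
    rw [hg] at h1
    have e : ∑ t ∈ Sb b ∩ Gᶜ, ν' t = (∑ t ∈ Sb b, ν' t) - ∑ t ∈ Sb b ∩ G, ν' t := by
      rw [← Finset.sdiff_eq_inter_compl, eq_sub_iff_add_eq, add_comm, Finset.sum_inter_add_sum_sdiff]
    rw [e]
    have : gb = 1 - g := by linarith
    rw [this]
    nlinarith [h1, hab0 b]
  have secGc' : ∀ b, ∑ t ∈ S'b b ∩ Gᶜ, ν' t ≤ gb * ab' b := by
    intro b
    have hup : IsUpperSet ((S'b b : Finset Q) : Set Q) := isUpperSet_secQ hS' b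
    have h1 := hHQ (S'b b) G hup hG
    rw [hg] at h1
    have e : ∑ t ∈ S'b b ∩ Gᶜ, ν' t = (∑ t ∈ S'b b, ν' t) - ∑ t ∈ S'b b ∩ G, ν' t := by
      rw [← Finset.sdiff_eq_inter_compl, eq_sub_iff_add_eq, add_comm, Finset.sum_inter_add_sum_sdiff]
    rw [e]
    have : gb = 1 - g := by linarith
    rw [this]
    nlinarith [h1, hab'0 b]
  -- total mass of `U`: `g + ḡ v`
  have eU : ∑ x ∈ U, ν x = g + gb * v := by
    have huniv : IsUpperSet ((univ : Finset (B × Q)) : Set (B × Q)) := by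
      rw [Finset.coe_univ]; exact isUpperSet_univ
    have h := secU univ huniv
    rw [Finset.univ_inter] at h
    rw [h]
    have e1 : ∀ t, (univ.filter fun b : B => (b, t) ∈ (univ : Finset (B × Q))) = univ := fun t => by ext b; simp
    have e2 : ∀ b, (univ.filter fun t : Q => (b, t) ∈ (univ : Finset (B × Q))) = univ := fun b => by ext t; simp
    simp only [e1, e2, hwZ, mul_one, Finset.univ_inter, hg]
    rw [← Finset.sum_mul, hv, hgb]; ring
  -- abbreviations for the aggregate quantities
  set A := ∑ x ∈ S, ν x with hAdef
  set A' := ∑ x ∈ S', ν x with hA'def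
  set AG := ∑ t ∈ G, ν' t * a t with hAG
  set AG' := ∑ t ∈ G, ν' t * a' t with hAG'
  set AVc := ∑ b ∈ V, w b * ∑ t ∈ Sb b ∩ Gᶜ, ν' t with hAVc
  set AVc' := ∑ b ∈ V, w b * ∑ t ∈ S'b b ∩ Gᶜ, ν' t with hAVc'
  set AV := ∑ b ∈ V, w b * ab b with hAV
  set AV' := ∑ b ∈ V, w b * ab' b with hAV'
  have hA0 : 0 ≤ A := Finset.sum_nonneg fun x _ => by rw [hν]; exact mul_nonneg (hw _) (hν' _)
  have hA'0 : 0 ≤ A' := Finset.sum_nonneg fun x _ => by rw [hν]; exact mul_nonneg (hw _) (hν' _)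
  have eSU : ∑ x ∈ S ∩ U, ν x = AG + AVc := secU S hS
  have eS'U : ∑ x ∈ S' ∩ U, ν x = AG' + AVc' := secU S' hS'
  -- (1) the `G`-part: functional pair inequality of `G` with `a, a'`, then Harris on `B` section by section
  have step1 : A * AG' + A' * AG - g * A * A' ≤ ∑ t, RG t * (a t * a' t) := by
    have h := pair_functional ν' RG G g hpairG ha0 ham ha'0 ha'm
    rw [← eA_B, ← eA'_B] at h
    exact h
  have step2 : ∑ t, RG t * (a t * a' t) ≤ ∑ t, RG t * ∑ b ∈ St t ∩ S't t, w b :=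
    Finset.sum_le_sum fun t _ => mul_le_mul_of_nonneg_left
      (hHB (St t) (S't t) (isUpperSet_secB hS t) (isUpperSet_secB hS' t)) (hRG0 t)
  -- (2) the `V`-part
  have step3 : A * AVc' + A' * AVc - v * gb * A * A' ≤ gb * (A * AV' + A' * AV - v * A * A') := by
    have h1 : AVc' ≤ gb * AV' := by
      rw [hAVc', hAV', Finset.mul_sum]
      exact Finset.sum_le_sum fun b _ => by
        have := secGc' b
        calc w b * ∑ t ∈ S'b b ∩ Gᶜ, ν' t ≤ w b * (gb * ab' b) := mul_le_mul_of_nonneg_left this (hw b)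
          _ = gb * (w b * ab' b) := by ring
    have h2 : AVc ≤ gb * AV := by
      rw [hAVc, hAV, Finset.mul_sum]
      exact Finset.sum_le_sum fun b _ => by
        have := secGc b
        calc w b * ∑ t ∈ Sb b ∩ Gᶜ, ν' t ≤ w b * (gb * ab b) := mul_le_mul_of_nonneg_left this (hw b)
          _ = gb * (w b * ab b) := by ring
    nlinarith [mul_le_mul_of_nonneg_left h1 hA0, mul_le_mul_of_nonneg_left h2 hA'0]
  have step4 : A * AV' + A' * AV - v * A * A' ≤ ∑ b, RV b * (ab b * ab' b) := by
    have h := pair_functional w RV V v hpairV hab0 habm hab'0 hab'm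
    rw [← eA_Q, ← eA'_Q] at h
    exact h
  have step5 : ∑ b, RV b * (ab b * ab' b) ≤ ∑ b, RV b * ∑ t ∈ Sb b ∩ S'b b, ν' t :=
    Finset.sum_le_sum fun b _ => mul_le_mul_of_nonneg_left
      (hHQ (Sb b) (S'b b) (isUpperSet_secQ hS b) (isUpperSet_secQ hS' b)) (hRV0 b)
  have hgb0 : 0 ≤ gb := by rw [← hgb]; exact Finset.sum_nonneg fun t _ => hν' t
  -- the right-hand side in section form
  have eR1 : ∑ x ∈ S ∩ S', w x.1 * RG x.2 = ∑ t, RG t * ∑ b ∈ St t ∩ S't t, w b := by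
    rw [sum_sectionsB]
    refine Finset.sum_congr rfl fun t _ => ?_
    rw [secB_inter, Finset.mul_sum]
    exact Finset.sum_congr rfl fun b _ => by ring
  have eR2 : ∑ x ∈ S ∩ S', gb * RV x.1 * ν' x.2 = gb * ∑ b, RV b * ∑ t ∈ Sb b ∩ S'b b, ν' t := by
    rw [sum_sectionsQ, Finset.mul_sum]
    refine Finset.sum_congr rfl fun b _ => ?_
    rw [secQ_inter, Finset.mul_sum, Finset.mul_sum]
    exact Finset.sum_congr rfl fun t _ => by ring
  have eR2' : ∑ x ∈ S ∩ S', (∑ t ∈ Gᶜ, ν' t) * RV x.1 * ν' x.2 = gb * ∑ b, RV b * ∑ t ∈ Sb b ∩ S'b b, ν' t := by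
    simp only [hgb]; exact eR2
  rw [Finset.sum_add_distrib, eR1, eR2', eSU, eS'U, eU]
  have hmid : gb * (A * AV' + A' * AV - v * A * A') ≤ gb * ∑ b, RV b * ∑ t ∈ Sb b ∩ S'b b, ν' t :=
    mul_le_mul_of_nonneg_left (le_trans step4 step5) hgb0
  linarith [step1, step2, step3, hmid]

end Summit.CriticalPhenomena.PercolationContinuityZ3.Theorems.SahiE3IndepOrMarginal
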